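import Literature.Probability.Percolation.ConditionalPositiveAssociationProofs
import HarnessLib

/-!
# Sandwich BHK inequality — preliminaries (towards `PercNearOneGluing.AdditiveGluing`,
the case `|A ∖ b| = 2`; file 1/5, `stub_sandwichMoat_k18`)

Percolation restricted to a vertex set `U` in the weight-sum framework of
`Literature.Probability.Percolation.BHK2006` (`weight`, `edgesIn`, `meeting`, `rC`, `rD`, `rS`),
written with LOCAL NOTATIONS only: the vertex set `rV[U, S, ω]` reachable from a source set `S`,
the connection event `rF[U, a, b]`, the *sandwich event*
`rE[U, o, R, X] = {o ↔ X} ∪ ({o ↮ X} ∩ {C(o) ∈ R})` (phrased decidability-free: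
`∃ W ∈ R, ∀ v, v ∈ W ↔ o ↔ v`), the moat event `rB[U, Y]` (no open edge of `G[U]` between `Y`
and `U ∖ Y`); their localisation to `G[U ∖ Y]`, the determinedness of `{rV = Y}` by the edges
meeting `Y`, the block-product identity for product weights, and the **moat lemma**
(`SandwichBHK.moat` = `stub_sandwichMoat_k18`): for `a ∉ Y` and an event `J` determined by the
edges meeting `Y` which forces the moat of `Y` closed,
`P(J, a↔b, a↮S) · P(a↮T) ≤ P(a↔b) · P(J, a↮S, a↮T)` — inside the moat the configuration is a
fresh percolation on `G[U ∖ Y]` (block product), where Harris (increasing × decreasing,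
decreasing × decreasing) applies, and deleting `Y` only lowers `P(a↔b)` and raises `P(a↮T)`.
Used by the base case of the sandwich induction (file 2/5).
-/

noncomputable section

open Literature.Probability.Percolation Literature.Probability.Percolation.BHK2006 DecisionTree

namespace Summit.CriticalPhenomena.PercolationContinuityZ3.Theorems.SandwichBHK

open scoped Classical

/-! Local notations (no new definitions): `ℙ[w] A` the weight-sum probability of the event `A`;
`rF[U, a, b]` the connection event `{a ↔ b}` of `G[U]`; `rV[U, S, ω]` the finite set of vertices of
`G[U]` reachable from the source set `S`; `rE[U, o, R, X]` the **sandwich event**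
`{o ↔ X} ∪ ({o ↮ X} ∩ {C(o) ∈ R})` for a collection `R` of vertex sets; `rB[U, Y]` the moat event
(no open edge between `Y` and `U ∖ Y`, i.e. BHK's random set of `Y` is empty). -/
local notation3 "ℙ[" w "] " A:max => ∑ ω, weight w ω * ind A ω
local notation3 "rF[" U ", " a ", " b "]" =>
  {ω : Set (Sym2 _) | (openGraph (ω ∩ edgesIn U)).Reachable a b}
local notation3 "rV[" U ", " S ", " ω "]" =>
  Finset.univ.filter (fun v => ∃ s ∈ (S : Set _), (openGraph (ω ∩ edgesIn U)).Reachable s v)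
local notation3 "rE[" U ", " o ", " R ", " X "]" =>
  {ω : Set (Sym2 _) | (∃ x ∈ (X : Set _), (openGraph (ω ∩ edgesIn U)).Reachable o x) ∨
    (ω ∈ rD U o X ∧ ∃ W ∈ (R : Set (Finset _)), ∀ v, v ∈ W ↔ (openGraph (ω ∩ edgesIn U)).Reachable o v)}
local notation3 "rB[" U ", " Y "]" => {ω : Set (Sym2 _) | ∀ n, n ∉ rS U Y ω}

section Block

variable {ι : Type*} [Fintype ι]

/-- `pr` is nonnegative. [folklore] -/
theorem pr_nonneg {w : ι → ℝ} (hw0 : ∀ e, 0 ≤ w e) (hw1 : ∀ e, w e ≤ 1) (A : Set (Set ι)) :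
    0 ≤ ℙ[w] A :=
  Finset.sum_nonneg fun ω _ => mul_nonneg (weight_nonneg hw0 hw1 ω) (ind_nonneg _ _)

/-- `pr` is monotone in the event. [folklore] -/
theorem pr_mono {w : ι → ℝ} (hw0 : ∀ e, 0 ≤ w e) (hw1 : ∀ e, w e ≤ 1) {A B : Set (Set ι)}
    (h : A ⊆ B) : ℙ[w] A ≤ ℙ[w] B :=
  Finset.sum_le_sum fun ω _ => mul_le_mul_of_nonneg_left (ind_mono h ω) (weight_nonneg hw0 hw1 ω)

/-- `ℙ[∅] = 0`. [folklore] -/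
theorem pr_empty (w : ι → ℝ) : ℙ[w] (∅ : Set (Set ι)) = 0 :=
  Finset.sum_eq_zero fun ω _ => by rw [ind_of_not_mem (Set.notMem_empty ω), mul_zero]

/-- `ℙ[univ] = 1` for normalised weights. [folklore] -/
theorem pr_univ (w : ι → ℝ) (hm : ∑ ω, weight w ω = 1) : ℙ[w] (Set.univ : Set (Set ι)) = 1 := by
  simp_rw [ind_of_mem (Set.mem_univ _), mul_one]
  exact hm

/-- **Block product.** For normalised product weights, a function of the `A`-block times a
function of the complementary block has expectation equal to the product of expectations.
[folklore] -/
theorem sum_block_mul (w : ι → ℝ) (hm : ∑ ω, weight w ω = 1) (A : Set ι) (f g : Set ι → ℝ) :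
    ∑ ω, weight w ω * (f (ω ∩ A) * g (ω \ A)) =
      (∑ ω, weight w ω * f (ω ∩ A)) * ∑ ω, weight w ω * g (ω \ A) := by
  have h := blockFubini w A (fun ζ η => f ζ * g η)
  rw [hm, one_mul] at h
  rw [h, Finset.sum_mul]
  refine Finset.sum_congr rfl fun ω _ => ?_
  have : ∀ ω', weight w ω' * (f (ω ∩ A) * g (ω' \ A)) = f (ω ∩ A) * (weight w ω' * g (ω' \ A)) :=
    fun ω' => by ring
  simp_rw [this, ← Finset.mul_sum]
  ring

/-- Linearity: the expectation of a finite combination of indicators. [folklore] -/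
theorem sum_weight_sum {κ : Type*} (s : Finset κ) (w : ι → ℝ) (c : κ → ℝ) (A : κ → Set (Set ι)) :
    ∑ ω, weight w ω * (∑ k ∈ s, c k * ind (A k) ω) = ∑ k ∈ s, c k * ℙ[w] (A k) := by
  simp_rw [Finset.mul_sum]
  rw [Finset.sum_comm]
  refine Finset.sum_congr rfl fun k _ => Finset.sum_congr rfl fun ω _ => ?_
  ring

end Block

section Graph

variable {V : Type*} [Fintype V]

/-- Membership in the reachable set `rV`. [folklore] -/
theorem mem_rV {U : Finset V} {S : Set V} {ω : Set (Sym2 V)} {v : V} :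
    v ∈ rV[U, S, ω] ↔ ∃ s ∈ S, (openGraph (ω ∩ edgesIn U)).Reachable s v := by
  simp

/-- Membership in the cluster `rV[U, {o}`, of] a single source. [folklore] -/
theorem mem_rV_singleton {U : Finset V} {o v : V} {ω : Set (Sym2 V)} :
    v ∈ rV[U, {o}, ω] ↔ (openGraph (ω ∩ edgesIn U)).Reachable o v := by
  simp

/-- The cluster of `o` is `W` iff `W` is exactly the set of vertices reachable from `o`. [folklore] -/
theorem rV_singleton_eq_iff {U : Finset V} {o : V} {ω : Set (Sym2 V)} {W : Finset V} :
    rV[U, {o}, ω] = W ↔ ∀ v, v ∈ W ↔ (openGraph (ω ∩ edgesIn U)).Reachable o v := by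
  rw [Finset.ext_iff]
  exact forall_congr' fun v => by rw [mem_rV_singleton]; exact iff_comm

/-- `{C(o) ∈ R}` in the two phrasings. [folklore] -/
theorem exists_iff_rV_mem {U : Finset V} {o : V} {ω : Set (Sym2 V)} {R : Set (Finset V)} :
    (∃ W ∈ R, ∀ v, v ∈ W ↔ (openGraph (ω ∩ edgesIn U)).Reachable o v) ↔ rV[U, {o}, ω] ∈ R := by
  constructor
  · rintro ⟨W, hW, h⟩
    rwa [rV_singleton_eq_iff.2 h]
  · intro h
    exact ⟨_, h, rV_singleton_eq_iff.1 rfl⟩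

/-- Sources are reachable. [folklore] -/
theorem self_mem_rV {U : Finset V} {S : Set V} {ω : Set (Sym2 V)} {s : V} (hs : s ∈ S) :
    s ∈ rV[U, S, ω] :=
  mem_rV.2 ⟨s, hs, SimpleGraph.Reachable.refl s⟩

omit [Fintype V] in
/-- A vertex reachable from `x ≠ y`… the endpoint of a nontrivial open path of `G[U]` lies in `U`.
[folklore] -/
theorem mem_of_reachable {U : Finset V} {ω : Set (Sym2 V)} {x y : V}
    (h : (openGraph (ω ∩ edgesIn U)).Reachable x y) (hne : x ≠ y) : y ∈ U := by
  rw [SimpleGraph.reachable_iff_reflTransGen] at h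
  rcases Relation.ReflTransGen.cases_tail h with rfl | ⟨c, -, hcy⟩
  · exact absurd rfl hne
  · exact (adj_iff.1 hcy).2.1.2

/-- `rV[U, S, ω] ⊆ U` when `S ⊆ U`. [folklore] -/
theorem rV_subset {U : Finset V} {S : Set V} (hSU : S ⊆ ↑U) (ω : Set (Sym2 V)) : rV[U, S, ω] ⊆ U := by
  intro v hv
  obtain ⟨s, hs, hr⟩ := mem_rV.1 hv
  by_cases hsv : s = v
  · subst hsv; exact hSU hs
  · exact mem_of_reachable hr hsv

/-- `rV` is increasing in the configuration. [folklore] -/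
theorem rV_mono (U : Finset V) (S : Set V) {ω ω' : Set (Sym2 V)} (h : ω ⊆ ω') :
    rV[U, S, ω] ⊆ rV[U, S, ω'] := fun v hv => by
  obtain ⟨s, hs, hr⟩ := mem_rV.1 hv
  exact mem_rV.2 ⟨s, hs, hr.mono (openGraph_le (Set.inter_subset_inter_left _ h))⟩

omit [Fintype V] in
/-- `{a ↔ b}` is increasing in the configuration. [folklore] -/
theorem rF_mono_config (U : Finset V) (a b : V) {ω ω' : Set (Sym2 V)} (h : ω ⊆ ω')
    (hω : ω ∈ rF[U, a, b]) : ω' ∈ rF[U, a, b] :=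
  SimpleGraph.Reachable.mono (openGraph_le (Set.inter_subset_inter_left _ h)) hω

omit [Fintype V] in
/-- The indicator of `{a ↔ b}` is monotone. [folklore] -/
theorem ind_rF_monotone (U : Finset V) (a b : V) : Monotone (ind (rF[U, a, b])) := by
  intro ω ω' h
  by_cases hω : ω ∈ rF[U, a, b]
  · rw [ind_of_mem hω, ind_of_mem (rF_mono_config U a b h hω)]
  · rw [ind_of_not_mem hω]; exact ind_nonneg _ _

omit [Fintype V] in
/-- `{a ↔ b in G[U']} ⊆ {a ↔ b in G[U]}` for `U' ⊆ U`. [folklore] -/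
theorem rF_mono_U {U U' : Finset V} (h : U' ⊆ U) (a b : V) : rF[U', a, b] ⊆ rF[U, a, b] := fun _ hω =>
  SimpleGraph.Reachable.mono (openGraph_le (Set.inter_subset_inter_right _ (edgesIn_mono h))) hω

omit [Fintype V] in
/-- `{a ↮ X in G[U]} ⊆ {a ↮ X in G[U']}` for `U' ⊆ U`. [folklore] -/
theorem rD_anti_U {U U' : Finset V} (h : U' ⊆ U) (a : V) (X : Set V) : rD U a X ⊆ rD U' a X :=
  fun _ hω x hx hr =>
    hω x hx (hr.mono (openGraph_le (Set.inter_subset_inter_right _ (edgesIn_mono h))))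

/-! #### Invariance under deleting the edges meeting `Y` -/

omit [Fintype V] in
/-- `{a ↔ b in G[U ∖ Y]}` does not depend on the edges meeting `Y`. [folklore] -/
theorem mem_rF_diff_meeting (U Y : Finset V) (a b : V) (ω : Set (Sym2 V)) :
    ω \ meeting Y ∈ rF[(U \ Y), a, b] ↔ ω ∈ rF[(U \ Y), a, b] := by
  simp only [Set.mem_setOf_eq, diff_meeting_inter_edgesIn]

/-- The reachable set of `G[U ∖ Y]` does not depend on the edges meeting `Y`. [folklore] -/
theorem rV_diff_meeting (U Y : Finset V) (S : Set V) (ω : Set (Sym2 V)) :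
    rV[(U \ Y), S, (ω \ meeting Y)] = rV[(U \ Y), S, ω] := by
  simp only [diff_meeting_inter_edgesIn]

omit [Fintype V] in
/-- The sandwich event of `G[U ∖ Y]` does not depend on the edges meeting `Y`. [folklore] -/
theorem mem_rE_diff_meeting (U Y : Finset V) (o : V) (R : Set (Finset V)) (X : Set V)
    (ω : Set (Sym2 V)) : ω \ meeting Y ∈ rE[(U \ Y), o, R, X] ↔ ω ∈ rE[(U \ Y), o, R, X] := by
  simp only [Set.mem_setOf_eq, diff_meeting_inter_edgesIn, mem_rD_diff_meeting]

/-! #### The reachable set is determined by the edges meeting it -/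

/-- If `rV[U, S, ω] = Y`, open paths from `S` only use edges meeting `Y`. [folklore] -/
theorem reach_inter_meeting_of_rV_eq {U Y : Finset V} {S : Set V} {ω : Set (Sym2 V)}
    (hY : rV[U, S, ω] = Y) {s : V} (hs : s ∈ S) {v : V}
    (hv : (openGraph (ω ∩ edgesIn U)).Reachable s v) :
    (openGraph ((ω ∩ meeting Y) ∩ edgesIn U)).Reachable s v := by
  rw [SimpleGraph.reachable_iff_reflTransGen] at hv
  induction hv with
  | refl => exact SimpleGraph.Reachable.refl s
  | tail hu huv ih =>
    rename_i u v'
    have huY : u ∈ Y := hY ▸ mem_rV.2 ⟨s, hs, (SimpleGraph.reachable_iff_reflTransGen _ _).2 hu⟩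
    obtain ⟨hω, hU, hne⟩ := adj_iff.1 huv
    refine ih.trans (SimpleGraph.Adj.reachable (adj_iff.2 ⟨⟨hω, u, huY, Sym2.mem_mk_left u v'⟩, hU, hne⟩))

/-- If `rV[U, S, (ω ∩ meeting Y)] = Y`, open paths of `ω` from `S` stay in `Y` and are open in
`ω ∩ meeting Y`. [folklore] -/
theorem reach_of_rV_inter_meeting_eq {U Y : Finset V} {S : Set V} {ω : Set (Sym2 V)}
    (hY : rV[U, S, (ω ∩ meeting Y)] = Y) {s : V} (hs : s ∈ S) {v : V}
    (hv : (openGraph (ω ∩ edgesIn U)).Reachable s v) :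
    v ∈ Y ∧ (openGraph ((ω ∩ meeting Y) ∩ edgesIn U)).Reachable s v := by
  rw [SimpleGraph.reachable_iff_reflTransGen] at hv
  induction hv with
  | refl => exact ⟨hY ▸ self_mem_rV hs, SimpleGraph.Reachable.refl s⟩
  | tail hu huv ih =>
    rename_i u v'
    obtain ⟨huY, hu'⟩ := ih
    obtain ⟨hω, hU, hne⟩ := adj_iff.1 huv
    have hr : (openGraph ((ω ∩ meeting Y) ∩ edgesIn U)).Reachable s v' :=
      hu'.trans (SimpleGraph.Adj.reachable (adj_iff.2 ⟨⟨hω, u, huY, Sym2.mem_mk_left u v'⟩, hU, hne⟩))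
    exact ⟨hY ▸ mem_rV.2 ⟨s, hs, hr⟩, hr⟩

/-- **Determinedness**: the event `{rV[U, S, =] Y}` depends only on the edges meeting `Y`. [folklore] -/
theorem rV_inter_meeting_eq_iff (U Y : Finset V) (S : Set V) (ω : Set (Sym2 V)) :
    rV[U, S, (ω ∩ meeting Y)] = Y ↔ rV[U, S, ω] = Y := by
  constructor
  · intro hY
    refine Finset.Subset.antisymm (fun v hv => ?_) ?_
    · obtain ⟨s, hs, hr⟩ := mem_rV.1 hv
      exact (reach_of_rV_inter_meeting_eq hY hs hr).1
    · rw [← hY]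
      exact rV_mono U S Set.inter_subset_left
  · intro hY
    refine Finset.Subset.antisymm ?_ (fun v hv => ?_)
    · rw [← hY]
      exact rV_mono U S Set.inter_subset_left
    · rw [← hY] at hv
      obtain ⟨s, hs, hr⟩ := mem_rV.1 hv
      exact mem_rV.2 ⟨s, hs, reach_inter_meeting_of_rV_eq hY hs hr⟩

/-- **Moat**: if `rV[U, S, ω] = Y` (with `S ⊆ U`) then no open edge joins `Y` to `U ∖ Y`. [folklore] -/
theorem rB_of_rV_eq {U Y : Finset V} {S : Set V} (hSU : S ⊆ ↑U) {ω : Set (Sym2 V)}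
    (hY : rV[U, S, ω] = Y) : ω ∈ rB[U, Y] := by
  intro n hn
  obtain ⟨hnUY, z, hzY, hnz⟩ := hn
  obtain ⟨hnU, hnY⟩ := Finset.mem_sdiff.1 hnUY
  have hzV : z ∈ rV[U, S, ω] := by rw [hY]; exact hzY
  obtain ⟨s, hs, hsz⟩ := mem_rV.1 hzV
  have hzU : z ∈ U := rV_subset hSU ω hzV
  have hne : z ≠ n := fun h => hnY (h ▸ hzY)
  have hadj : (openGraph (ω ∩ edgesIn U)).Adj z n :=
    adj_iff.2 ⟨by rw [Sym2.eq_swap]; exact hnz, ⟨hzU, hnU⟩, hne⟩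
  exact hnY (hY ▸ mem_rV.2 ⟨s, hs, hsz.trans hadj.reachable⟩)

/-! #### Localisation to `G[U ∖ Y]` on the moat event -/

omit [Fintype V] in
/-- On the moat event, `{a ↔ b in G[U]} = {a ↔ b in G[U ∖ Y]}` for `a ∉ Y`. [folklore] -/
theorem rF_iff_of_rB {U Y : Finset V} {a b : V} (haY : a ∉ Y) {ω : Set (Sym2 V)}
    (hω : ω ∈ rB[U, Y]) : ω ∈ rF[U, a, b] ↔ ω ∈ rF[(U \ Y), a, b] := by
  constructor
  · intro h
    exact (reach_restrict (U := U) (Z := Y) haY (fun n hn _ => hω n hn) h).2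
  · exact fun h => rF_mono_U Finset.sdiff_subset a b h

omit [Fintype V] in
/-- On the moat event, `{a ↮ X in G[U]} = {a ↮ X in G[U ∖ Y]}` for `a ∉ Y`. [folklore] -/
theorem rD_iff_of_rB {U Y : Finset V} {a : V} (haY : a ∉ Y) (X : Set V) {ω : Set (Sym2 V)}
    (hω : ω ∈ rB[U, Y]) : ω ∈ rD U a X ↔ ω ∈ rD (U \ Y) a X := by
  constructor
  · exact fun h => rD_anti_U Finset.sdiff_subset a X h
  · intro h x hx hr
    exact h x hx (reach_restrict (U := U) (Z := Y) haY (fun n hn _ => hω n hn) hr).2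

/-! #### The moat lemma -/

variable {w : Sym2 V → ℝ}

/-- Harris: an increasing and a decreasing event are negatively correlated. [cite: VandenbergHaggstromKahn2005, §1 p. 4, display (4)] -/
theorem pr_inter_le_mul_of_mono_anti (hw0 : ∀ e, 0 ≤ w e) (hw1 : ∀ e, w e ≤ 1)
    (hm : ∑ ω, weight w ω = 1) {A B : Set (Set (Sym2 V))} (hA : Monotone (ind A))
    (hB : Antitone (ind B)) : ℙ[w] (A ∩ B) ≤ ℙ[w] A * ℙ[w] B := by
  simp_rw [ind_inter]
  exact harris_mono_anti hw0 hw1 hm (fun _ => ind_nonneg _ _) hA hB (fun _ => ind_le_one _ _)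

/-- Harris: two decreasing events are positively correlated. [cite: VandenbergHaggstromKahn2005, §1 p. 4, display (4)] -/
theorem mul_le_pr_inter_of_anti_anti (hw0 : ∀ e, 0 ≤ w e) (hw1 : ∀ e, w e ≤ 1)
    (hm : ∑ ω, weight w ω = 1) {A B : Set (Set (Sym2 V))} (hA : Antitone (ind A))
    (hB : Antitone (ind B)) : ℙ[w] A * ℙ[w] B ≤ ℙ[w] (A ∩ B) := by
  simp_rw [ind_inter]
  exact harris_anti_anti hw0 hw1 hm hA hB (fun _ => ind_le_one _ _) (fun _ => ind_le_one _ _)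

/-- **Block product for events**: `J` determined by the edges meeting `Y`, `A` by the others.
[folklore] -/
theorem pr_inter_eq_mul (hm : ∑ ω, weight w ω = 1) (Y : Finset V) {J A : Set (Set (Sym2 V))}
    (hJ : ∀ ω, ω ∈ J ↔ ω ∩ meeting Y ∈ J) (hA : ∀ ω, ω \ meeting Y ∈ A ↔ ω ∈ A) :
    ℙ[w] (J ∩ A) = ℙ[w] J * ℙ[w] A := by
  have hpt : ∀ ω, ind (J ∩ A) ω = ind J (ω ∩ meeting Y) * ind A (ω \ meeting Y) := by
    intro ω
    rw [ind_inter]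
    congr 1
    · by_cases h : ω ∈ J
      · rw [ind_of_mem h, ind_of_mem ((hJ ω).1 h)]
      · rw [ind_of_not_mem h, ind_of_not_mem (fun h' => h ((hJ ω).2 h'))]
    · by_cases h : ω ∈ A
      · rw [ind_of_mem h, ind_of_mem ((hA ω).2 h)]
      · rw [ind_of_not_mem h, ind_of_not_mem (fun h' => h ((hA ω).1 h'))]
  have hJ' : ∀ ω, ind J (ω ∩ meeting Y) = ind J ω := fun ω => by
    by_cases h : ω ∈ J
    · rw [ind_of_mem h, ind_of_mem ((hJ ω).1 h)]
    · rw [ind_of_not_mem h, ind_of_not_mem (fun h' => h ((hJ ω).2 h'))]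
  have hA' : ∀ ω, ind A (ω \ meeting Y) = ind A ω := fun ω => by
    by_cases h : ω ∈ A
    · rw [ind_of_mem h, ind_of_mem ((hA ω).2 h)]
    · rw [ind_of_not_mem h, ind_of_not_mem (fun h' => h ((hA ω).1 h'))]
  simp_rw [hpt]
  rw [sum_block_mul w hm (meeting Y) (ind J) (ind A)]
  simp_rw [hJ', hA']

/-- **Moat lemma.** Let `a ∉ Y ⊆ U` and let `J` be an event determined by the edges meeting
`Y` which forces the moat of `Y` to be closed. Then
`P(J, a ↔ b, a ↮ S) · P(a ↮ T) ≤ P(a ↔ b) · P(J, a ↮ S, a ↮ T)`: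
inside the moat the configuration is a fresh percolation on `G[U ∖ Y]`, where Harris applies,
and deleting `Y` only lowers `P(a ↔ b)` and raises `P(a ↮ T)`. [new] -/
theorem moat (hw0 : ∀ e, 0 ≤ w e) (hw1 : ∀ e, w e ≤ 1) (hm : ∑ ω, weight w ω = 1)
    {U Y : Finset V} {a b : V} (haY : a ∉ Y) {J : Set (Set (Sym2 V))}
    (hJdet : ∀ ω, ω ∈ J ↔ ω ∩ meeting Y ∈ J) (hJB : J ⊆ rB[U, Y]) (S T : Set V) :
    ℙ[w] (J ∩ rF[U, a, b] ∩ rD U a S) * ℙ[w] (rD U a T) ≤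
      ℙ[w] (rF[U, a, b]) * ℙ[w] (J ∩ rD U a S ∩ rD U a T) := by
  set U' := U \ Y with hU'
  have hloc1 : J ∩ rF[U, a, b] ∩ rD U a S = J ∩ (rF[U', a, b] ∩ rD U' a S) := by
    ext ω
    simp only [Set.mem_inter_iff]
    constructor
    · rintro ⟨⟨hJ, hF⟩, hD⟩
      exact ⟨hJ, (rF_iff_of_rB haY (hJB hJ)).1 hF, (rD_iff_of_rB haY S (hJB hJ)).1 hD⟩
    · rintro ⟨hJ, hF, hD⟩
      exact ⟨⟨hJ, (rF_iff_of_rB haY (hJB hJ)).2 hF⟩, (rD_iff_of_rB haY S (hJB hJ)).2 hD⟩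
  have hloc2 : J ∩ rD U a S ∩ rD U a T = J ∩ (rD U' a S ∩ rD U' a T) := by
    ext ω
    simp only [Set.mem_inter_iff]
    constructor
    · rintro ⟨⟨hJ, hS⟩, hT⟩
      exact ⟨hJ, (rD_iff_of_rB haY S (hJB hJ)).1 hS, (rD_iff_of_rB haY T (hJB hJ)).1 hT⟩
    · rintro ⟨hJ, hS, hT⟩
      exact ⟨⟨hJ, (rD_iff_of_rB haY S (hJB hJ)).2 hS⟩, (rD_iff_of_rB haY T (hJB hJ)).2 hT⟩
  have k1 : ℙ[w] (J ∩ rF[U, a, b] ∩ rD U a S) = ℙ[w] J * ℙ[w] (rF[U', a, b] ∩ rD U' a S) := by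
    rw [hloc1]
    refine pr_inter_eq_mul hm Y hJdet fun ω => ?_
    simp only [Set.mem_inter_iff, hU', mem_rF_diff_meeting, mem_rD_diff_meeting]
  have k2 : ℙ[w] (J ∩ rD U a S ∩ rD U a T) = ℙ[w] J * ℙ[w] (rD U' a S ∩ rD U' a T) := by
    rw [hloc2]
    refine pr_inter_eq_mul hm Y hJdet fun ω => ?_
    simp only [Set.mem_inter_iff, hU', mem_rD_diff_meeting]
  have h3 : ℙ[w] (rF[U', a, b] ∩ rD U' a S) ≤ ℙ[w] (rF[U', a, b]) * ℙ[w] (rD U' a S) :=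
    pr_inter_le_mul_of_mono_anti hw0 hw1 hm (ind_rF_monotone U' a b) (ind_rD_antitone U' a S)
  have h4 : ℙ[w] (rD U' a S) * ℙ[w] (rD U' a T) ≤ ℙ[w] (rD U' a S ∩ rD U' a T) :=
    mul_le_pr_inter_of_anti_anti hw0 hw1 hm (ind_rD_antitone U' a S) (ind_rD_antitone U' a T)
  have h5 : ℙ[w] (rF[U', a, b]) ≤ ℙ[w] (rF[U, a, b]) := pr_mono hw0 hw1 (rF_mono_U Finset.sdiff_subset a b)
  have h6 : ℙ[w] (rD U a T) ≤ ℙ[w] (rD U' a T) := pr_mono hw0 hw1 (rD_anti_U Finset.sdiff_subset a T)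
  have nJ := pr_nonneg hw0 hw1 (w := w) J
  have nF' := pr_nonneg hw0 hw1 (w := w) (rF[U', a, b])
  have nF := pr_nonneg hw0 hw1 (w := w) (rF[U, a, b])
  have nS' := pr_nonneg hw0 hw1 (w := w) (rD U' a S)
  have nT := pr_nonneg hw0 hw1 (w := w) (rD U a T)
  have nT' := pr_nonneg hw0 hw1 (w := w) (rD U' a T)
  have nFS' := pr_nonneg hw0 hw1 (w := w) (rF[U', a, b] ∩ rD U' a S)
  rw [k1, k2]
  calc ℙ[w] J * ℙ[w] (rF[U', a, b] ∩ rD U' a S) * ℙ[w] (rD U a T)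
      ≤ ℙ[w] J * (ℙ[w] (rF[U', a, b]) * ℙ[w] (rD U' a S)) * ℙ[w] (rD U' a T) :=
        mul_le_mul (mul_le_mul_of_nonneg_left h3 nJ) h6 nT
          (mul_nonneg nJ (mul_nonneg nF' nS'))
    _ = ℙ[w] (rF[U', a, b]) * (ℙ[w] J * (ℙ[w] (rD U' a S) * ℙ[w] (rD U' a T))) := by ring
    _ ≤ ℙ[w] (rF[U, a, b]) * (ℙ[w] J * ℙ[w] (rD U' a S ∩ rD U' a T)) :=
        mul_le_mul h5 (mul_le_mul_of_nonneg_left h4 nJ) (mul_nonneg nJ (mul_nonneg nS' nT')) nF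

end Graph

end Summit.CriticalPhenomena.PercolationContinuityZ3.Theorems.SandwichBHK

namespace Summit.CriticalPhenomena.PercolationContinuityZ3.Theorems

open Literature.Probability.LatticeModels Literature.Probability.Percolation
open scoped Classical

/-- **The moat lemma `stub_sandwichMoat_k18`** (file 1/5): `SandwichBHK.moat` on `Fin n`. -/
theorem stub_sandwichMoat_k18 :
    ∀ (n : ℕ) (w : Sym2 (Fin n) → ℝ), (∀ e, 0 ≤ w e) → (∀ e, w e ≤ 1) → ∑ ω, Literature.Probability.Percolation.BHK2006.weight w ω = 1 → ∀ (U Y : Finset (Fin n)) (a b : Fin n), a ∉ Y → ∀ (J : Set (Set (Sym2 (Fin n)))), (∀ ω, ω ∈ J ↔ ω ∩ Literature.Probability.Percolation.BHK2006.meeting Y ∈ J) → J ⊆ {ω : Set (Sym2 (Fin n)) | ∀ v, v ∉ Literature.Probability.Percolation.BHK2006.rS U Y ω} → ∀ (S T : Set (Fin n)), (∑ ω, Literature.Probability.Percolation.BHK2006.weight w ω * Literature.Probability.Percolation.DecisionTree.ind (J ∩ {ω : Set (Sym2 (Fin n)) | (openGraph (ω ∩ Literature.Probability.Percolation.BHK2006.edgesIn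 U)).Reachable a b} ∩ Literature.Probability.Percolation.BHK2006.rD U a S) ω) * (∑ ω, Literature.Probability.Percolation.BHK2006.weight w ω * Literature.Probability.Percolation.DecisionTree.ind (Literature.Probability.Percolation.BHK2006.rD U a T) ω) ≤ (∑ ω, Literature.Probability.Percolation.BHK2006.weight w ω * Literature.Probability.Percolation.DecisionTree.ind {ω : Set (Sym2 (Fin n)) | (openGraph (ω ∩ Literature.Probability.Percolation.BHK2006.edgesIn U)).Reachable a b} ω) * (∑ ω, Literature.Probability.Percolation.BHK2006.weight w ω * Literature.Probability.Percolation.DecisionTree.ind (J ∩ Literature.Probability.Percolation.BHK2006.rD U a S ∩ Literature.Probability.Percolation.BHK2006.rD U a T) ω) :=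
  fun _ _ hw0 hw1 hm _ _ _ _ haY _ hJdet hJB S T => SandwichBHK.moat hw0 hw1 hm haY hJdet hJB S T

end Summit.CriticalPhenomena.PercolationContinuityZ3.Theorems
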